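import Mathlib
import Summits.ResolutionOfSingularities.ResolutionOfSingularities.Theorems.WildQuotientsKiralyLutkebohmert

/-!
# Cyclic divisorial transfer — regularity of the fixed ring at a totally ramified prime

Stub `stub_locFixedRegular` of crux stmt-ResolutionOfSingularities-15640 (line `Sketch`):
`B` a domain, `σ ≠ 1` a ring automorphism with `σ ^ p = 1` (`p` prime), `A = B^σ = eqLocus σ id`,
`𝔮 ⊂ B` a prime with `B_𝔮` regular local such that the augmentation ideal `(σ b - b : b ∈ B)` becomes
principal in `B_𝔮`, and `σ'` an automorphism of `B_𝔮` extending `σ`.  Given that the canonical map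
`A_𝔭 → B_𝔮` (`𝔭 = 𝔮 ∩ A`) is injective with image the fixed ring of `σ'`, the local ring `A_𝔭` is
regular: `σ'` is again of order `p` and `≠ 1`, its augmentation ideal is the extension of that of `σ`,
hence principal, so `(B_𝔮)^{σ'}` is regular local by Király–Lütkebohmert (Theorem 2, proved in
`Theorems.kl_isRegularLocalRing_eqLocus`), and `A_𝔭 ≅ (B_𝔮)^{σ'}`.
-/

set_option linter.dupNamespace false

noncomputable section

open IsLocalRing

namespace Summit.ResolutionOfSingularities.ResolutionOfSingularities.Theorems.WildQuotientResolution.CyclicTransfer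

/-- Powers of an automorphism `σ'` of a localization `L` of `B` compatible with an automorphism `σ`
of `B` are compatible with the corresponding powers of `σ`. -/
theorem locAut_pow_algebraMap {B : Type} [CommRing B] {L : Type} [CommRing L] [Algebra B L]
    (σ : B ≃+* B) (σ' : L ≃+* L)
    (hσ' : ∀ b : B, σ' (algebraMap B L b) = algebraMap B L (σ b)) (n : ℕ) (b : B) :
    (σ' ^ n) (algebraMap B L b) = algebraMap B L ((σ ^ n) b) := by
  induction n generalizing b with
  | zero => rfl
  | succ n ih => rw [pow_succ', pow_succ', RingAut.mul_apply, RingAut.mul_apply, ih, hσ']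

/-- The augmentation ideal of an automorphism `σ'` of the localization `B_𝔮` extending an
automorphism `σ` of `B` is the extension of the augmentation ideal of `σ`. -/
theorem augIdeal_locAut_eq_map {B : Type} [CommRing B] (σ : B ≃+* B) (𝔮 : Ideal B) [𝔮.IsPrime]
    (σ' : Localization.AtPrime 𝔮 ≃+* Localization.AtPrime 𝔮)
    (hσ' : ∀ b : B, σ' (algebraMap B (Localization.AtPrime 𝔮) b) =
      algebraMap B (Localization.AtPrime 𝔮) (σ b)) :
    Ideal.span (Set.range fun x : Localization.AtPrime 𝔮 => σ' x - x) =
      (Ideal.span (Set.range fun b : B => σ b - b)).map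
        (algebraMap B (Localization.AtPrime 𝔮)) := by
  set L := Localization.AtPrime 𝔮
  set I : Ideal B := Ideal.span (Set.range fun b : B => σ b - b) with hI
  apply le_antisymm
  · rw [Ideal.span_le]
    rintro _ ⟨x, rfl⟩
    obtain ⟨b, t, rfl⟩ := IsLocalization.exists_mk'_eq 𝔮.primeCompl x
    have hu : IsUnit (algebraMap B L t) := IsLocalization.map_units L t
    have hu' : IsUnit (σ' (algebraMap B L t)) := hu.map σ'
    have hxu : IsLocalization.mk' L b t * algebraMap B L t = algebraMap B L b :=
      IsLocalization.mk'_spec L b t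
    have h2 : σ' (IsLocalization.mk' L b t) * σ' (algebraMap B L t) = algebraMap B L (σ b) := by
      rw [← map_mul, hxu, hσ']
    rw [SetLike.mem_coe, ← Ideal.mul_unit_mem_iff_mem _ (hu.mul hu')]
    have key : (σ' (IsLocalization.mk' L b t) - IsLocalization.mk' L b t) *
        (algebraMap B L t * σ' (algebraMap B L t)) =
        algebraMap B L ((σ b - b) * t - b * (σ t - t)) := by
      rw [show (σ b - b) * (t : B) - b * (σ t - t) = σ b * t - b * σ t by ring, map_sub, map_mul,
        map_mul]
      linear_combination (algebraMap B L t) * h2 - (σ' (algebraMap B L t)) * hxu -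
        (algebraMap B L b) * hσ' t
    rw [key]
    exact Ideal.mem_map_of_mem _ (I.sub_mem (I.mul_mem_right _ (Ideal.subset_span ⟨b, rfl⟩))
      (I.mul_mem_left _ (Ideal.subset_span ⟨(t : B), rfl⟩)))
  · rw [Ideal.map_span, Ideal.span_le]
    rintro _ ⟨_, ⟨b, rfl⟩, rfl⟩
    rw [SetLike.mem_coe, map_sub, ← hσ' b]
    exact Ideal.subset_span ⟨_, rfl⟩

/-- **Stub `stub_locFixedRegular`** (Király–Lütkebohmert at a totally ramified prime): `B` a domain,
`σ ≠ 1` of prime order `p`, `A = B^σ`, `𝔮` a prime of `B` with `B_𝔮` regular local and the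
augmentation ideal `(σ b - b : b ∈ B)` principal after localisation at `𝔮`; GIVEN that `A_𝔭 → B_𝔮`
(`𝔭 = 𝔮 ∩ A`) is injective with image the fixed ring of an automorphism `σ'` of `B_𝔮` compatible with
`σ`, the local ring `A_𝔭` is regular: `σ'` has order `p`, is `≠ 1` (`B ↪ B_𝔮`), its augmentation ideal
is the extension of that of `σ`, hence principal, so `(B_𝔮)^{σ'}` is regular by Király–Lütkebohmert
Thm 2 (`Theorems.kl_isRegularLocalRing_eqLocus`), and `A_𝔭 ≅ (B_𝔮)^{σ'}`.
[cite: KiralyLutkebohmert2013, Thm 2] -/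
theorem stub_locFixedRegular {B : Type} [CommRing B] [IsDomain B] {p : ℕ} (hp : p.Prime)
    (σ : B ≃+* B) (hσ1 : σ ≠ RingEquiv.refl B) (hσp : σ ^ p = RingEquiv.refl B)
    (𝔮 : Ideal B) [𝔮.IsPrime] [IsRegularLocalRing (Localization.AtPrime 𝔮)]
    (hdiv : ((Ideal.span (Set.range fun b : B => σ b - b)).map
      (algebraMap B (Localization.AtPrime 𝔮))).IsPrincipal)
    (σ' : Localization.AtPrime 𝔮 ≃+* Localization.AtPrime 𝔮)
    (hσ' : ∀ b : B, σ' (algebraMap B (Localization.AtPrime 𝔮) b) =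
      algebraMap B (Localization.AtPrime 𝔮) (σ b))
    (hinj : Function.Injective (Localization.localRingHom
        (𝔮.comap ((σ : B →+* B).eqLocus (RingHom.id B)).subtype) 𝔮
        ((σ : B →+* B).eqLocus (RingHom.id B)).subtype rfl))
    (hrange : (Localization.localRingHom (𝔮.comap ((σ : B →+* B).eqLocus (RingHom.id B)).subtype) 𝔮
        ((σ : B →+* B).eqLocus (RingHom.id B)).subtype rfl).range =
        (σ' : Localization.AtPrime 𝔮 →+* Localization.AtPrime 𝔮).eqLocus (RingHom.id _)) :
    IsRegularLocalRing
      (Localization.AtPrime (𝔮.comap ((σ : B →+* B).eqLocus (RingHom.id B)).subtype)) := by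
  set L := Localization.AtPrime 𝔮
  -- (a) `σ'` is not the identity, since `B ↪ B_𝔮` and `σ ≠ 1`.
  have hσ'1 : σ' ≠ RingEquiv.refl L := by
    intro h
    apply hσ1
    ext b
    have h1 := hσ' b
    rw [h, RingEquiv.refl_apply] at h1
    exact (IsLocalization.injective L 𝔮.primeCompl_le_nonZeroDivisors h1).symm
  -- (b) `σ' ^ p = 1`: both sides agree on the image of `B`.
  have hσ'p : σ' ^ p = RingEquiv.refl L := by
    have key : ((σ' ^ p : L ≃+* L) : L →+* L) = ((RingEquiv.refl L : L ≃+* L) : L →+* L) := by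
      refine IsLocalization.ringHom_ext 𝔮.primeCompl ?_
      ext b
      simp only [RingHom.coe_comp, RingHom.coe_coe, Function.comp_apply, RingEquiv.refl_apply]
      rw [locAut_pow_algebraMap σ σ' hσ' p b, hσp, RingEquiv.refl_apply]
    exact RingEquiv.ext fun x => RingHom.congr_fun key x
  -- (c) the augmentation ideal of `σ'` is the extended one, hence principal.
  have hP : (Ideal.span (Set.range fun x : L => σ' x - x)).IsPrincipal := by
    rw [augIdeal_locAut_eq_map σ 𝔮 σ' hσ']
    exact hdiv
  -- Király–Lütkebohmert, Theorem 2.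
  haveI : IsRegularLocalRing ((σ' : L →+* L).eqLocus (RingHom.id L)) :=
    kl_isRegularLocalRing_eqLocus hp L σ' hσ'1 hσ'p hP
  -- `A_𝔭 ≅ (B_𝔮)^{σ'}`.
  set φ := Localization.localRingHom (𝔮.comap ((σ : B →+* B).eqLocus (RingHom.id B)).subtype) 𝔮
    ((σ : B →+* B).eqLocus (RingHom.id B)).subtype rfl with hφ
  have hbij : Function.Bijective φ.rangeRestrict :=
    ⟨fun x y h => hinj (congrArg Subtype.val h), φ.rangeRestrict_surjective⟩
  let e : Localization.AtPrime (𝔮.comap ((σ : B →+* B).eqLocus (RingHom.id B)).subtype) ≃+*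
      (σ' : L →+* L).eqLocus (RingHom.id L) :=
    (RingEquiv.ofBijective φ.rangeRestrict hbij).trans (RingEquiv.subringCongr hrange)
  exact IsRegularLocalRing.of_ringEquiv e.symm

end Summit.ResolutionOfSingularities.ResolutionOfSingularities.Theorems.WildQuotientResolution.CyclicTransfer

end
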